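import Summits.AnomalousDissipation.AnomalousDissipation.Theses.InviscidWork

/-!
# Glue of the split of `InviscidWork.ViscousSelection` (stmt-AnomalousDissipation-28793)

Sorry-free proof of the GLUE item `InviscidWork.ViscousSelectionGlue` (stmt-AnomalousDissipation-30041):
`BilateralSelection → SelectionEnergyIdentity → ViscousSelection` (`SelectionEnergyIdentity := SteadyEnergyIdentity` by name).
Mechanism (lens-6 g7 kernel `refines_28793 = viscousSelection_iff_tree ∘ vs_of_sel ∘ sel_of_bilateral`): drop the reversed half of the
bilateral witness (projection to the hub), then convert its WORK floor `c ≤ ∫ h·w_j` into the DISSIPATION floor of 28793 by the steady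
energy identity `ν_j‖∇w_j‖² = ∫ h·w_j` and the constant-signal `limsup` mean.  No facts are asserted.
Source: decomp-ad cell, lens-6 g7 node «BilateralWork» v2 (kernel `run/shared/lean/pub/decomp-ad/decomp-ad-lens-6/BilateralWork.lean`,
theorems `sel_of_bilateral`, `steadyWorkAt_iff`, `vs_of_sel`, `refines_28793`); landed by the cell's prover seat against the tree-inlined texts.
-/

set_option linter.dupNamespace false

open MeasureTheory Filter Topology Set
open scoped ENNReal NNReal

noncomputable section

namespace Summit.AnomalousDissipation.AnomalousDissipation.Theorems.ViscousSelectionGlue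

open Literature.Analysis.FunctionSpaces Literature.Analysis.FunctionSpaces.Torus
open Literature.Analysis.FluidPDE Literature.Analysis.FluidPDE.Torus
open Summit.AnomalousDissipation.AnomalousDissipation.Theses.InviscidWork

/-- The GLUE item `InviscidWork.ViscousSelectionGlue` (stmt-AnomalousDissipation-30041) holds. [folklore] -/
theorem viscousSelectionGlue_holds : ViscousSelectionGlue := by
  intro hB hE ψ hRA hIW
  -- the `limsup` Cesàro mean of a constant signal is the constant (re-derived locally)
  have hmean : ∀ c : ℝ, longTimeAvgSup (fun _ : ℝ => c) = c := by
    intro c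
    have hc : (timeMean (fun _ : ℝ => c)) =ᶠ[atTop] fun _ => c := by
      filter_upwards [eventually_gt_atTop (0 : ℝ)] with T hT
      rw [timeMean, intervalIntegral.integral_const, smul_eq_mul, sub_zero]
      field_simp
    unfold longTimeAvgSup
    rw [Filter.limsup_congr hc, Filter.limsup_const]
  obtain ⟨h, hS, -⟩ := hB ψ hRA hIW
  obtain ⟨hh, hh0, F, ν, Fs, v, w, hF, hC, ⟨hw2, hweak, hceil⟩, c, hc, hfloor⟩ := hS
  refine ⟨h, hh, hh0, F, ν, Fs, v, w, hF, hC, hw2, hweak, hceil, c, hc, fun j => ?_⟩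
  obtain ⟨hν, -, -, -, hv, -⟩ := hC
  have hid := hE (ν j) h (w j) (v j) (hν j) hh (hv j).1 (hv j).2.1 (hw2 j) (hweak j)
  rw [hmean, hid.2]
  exact hfloor j

end Summit.AnomalousDissipation.AnomalousDissipation.Theorems.ViscousSelectionGlue

end
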